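import Summits.QuantumFields.YangMills.Theorems.BalabanUVNodesK0AxDecayBoxD9
import Summits.QuantumFields.YangMills.Theorems.BalabanUVNodesPortS1BoxEditions
import Summits.QuantumFields.YangMills.Theorems.BalabanUVNodesPortHRecordJoinToDoor

/-!
# BalabanUVNodes — K0ᴬ BY NAME FROM ⁸-ON-THE-BOX, THE JOIN's COFINAL ANTECEDENT PACKAGE AND A CHART-ROW SUPPLIER (the box road's analogue of ✓`K0RecordDecayRoadFromTexts.record13SepCoPHInhabitedAx_of_texts`)
  (★ P3 g90 `ym-nodeO-ideate-p3`, LENS P3 «weaken the target», №12; tree names only; ONE theorem, no `def`, no `sorry`)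

LANDING NOTE (porter ▶ PTC-1 g4, 2026-08-31; AUTHORSHIP = ★ P3 g90 «weaken the target», HOME sketch `nodeO-cover/P3-K0AxDoorOfSig8Box-v1.lean` sha16 df9fb4b972031458 · 80 l. · 1 thm · 0 def · 0
sorry): landed VERBATIM (only this paragraph added) under the basename ★★★ director-ym №560 (i) named (`…Theorems/BalabanUVNodesK0AxDoorOfSig8Box.lean`, «after INTENT-48 (№9A) lands»), after
✓p820563 `…K0AxDecayBoxD9` and ✓`…PortS1BoxEditions` (№11); `--supports stmt-QuantumFields-27238 --as helper` (NO `--workitem`); ◆ CRIT-1 g37 read №12 «every line» (l.5177: №12's door composes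
⁸-box's existential `ε₂₉` correctly — `hRows` asked at EVERY `ε₂₉ > 0`; `γ₀ ↦ min γ₀ ½`, `a₀ := a`, `Mg := 4·Mc`; dedup fresh) and ★★★ №560 (iii) booked this theorem as the K0ᴬ BOX ROAD OF RECORD
displaying {D1-box `Sig8LR4Box` · `JoinAntecedentsCofinal` · chart rows}.  HONEST (porter): a CONDITIONAL door (kernel implication from DISPLAYED texts∕rows to K0ᴬ by name; audit
`proof.conditional`, credits nothing); `Sig8LR4Box` ADOPTED target text, OPEN, proved NOWHERE; `JoinAntecedentsCofinal` ∕ chart rows inhabited NOWHERE; nothing of Bałaban asserted, ported,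
discharged or refuted; K0ᴬ stmt-QuantumFields-27238 OPEN — NOTHING of it proved; ⟨27930⟩∕⟨26648⟩ OPEN; NODE O 0∕1; COUNT 8∕28 · K 1∕4 UNMOVED; finite 𝕋⁴ at fixed ε — NOT continuum ∕ OS ∕ Clay; the
Yang–Mills mass gap is NOT proved by any of this.

WHAT.  The RUNS road of record reads K0ᴬ from the signed texts: ✓`K0RecordDecayRoadFromTexts.record13SepCoPHInhabitedAx_of_texts (Tok) (hBr) (h8 : ∀ F, Sig8LR4 F) (h7 : ∀ F, Sig7With Tok F)
(hA : ∀ F, JoinAntecedentsCofinal Tok F) (h121)`.  This file is the BOX road's twin over ★ P3 №9's token-free door ✓∕★`record13SepCoPHInhabitedAx_of_chartRowsBox_cofinalRadii` (`…K0AxDecayBoxD9` :303):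

  ★★★ `record13SepCoPHInhabitedAx_of_sig8LR4Box_antecedents_chartRows (Tok) (hBr : Tok ⟹ TokP9L4Old) (h8 : ∀ F, Sig8LR4Box F) (hA : ∀ F, JoinAntecedentsCofinal Tok F) (hRows) : Record13SepCoPHInhabitedAx`

where `Sig8LR4Box` is №11's box edition of ⁸ (✓∕★`…PortS1BoxEditions` :64), `JoinAntecedentsCofinal` is the JOIN's displayed supply shape (✓`…PortHRecordJoinToDoor` :111: for every threshold and radius the
thirteen antecedents of ⁸ at some `Mc ≥ Mth` — its token conjunct `Tok F Mc a₀` bridged to ⁸'s own thirteenth antecedent `TokP9L4Old` exactly as in the run road), and `hRows` is the CHART-ROW SUPPLIER: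
for every admissible `Mc`, radius `a₀ > 0` and EVERY `ε₂₉ > 0` (⁸'s `ε₂₉` is existential — ◆ CRIT-1 l.5032 composition note) ONE chart `ιC` with the equivariant-swap row against `recordEmbJ` and the
`C²`∕zero∕link rows against `recordGkLocWξ … univ` (№9A's rows VERBATIM; ◇ lens-1's (R-a) parts supply them at `ιC♮ := recordEmbJDressed` from (C-orb) + `DressLink`).  NO ⁷, NO (1.21) letter, NO
moment letter, NO two-volume token: compared with the run road's binder list, `h7` and `h121` are GONE and `h8` is asked ON THE BOX.  Proof: radius `a₀ := a` itself (the JOIN's package is supplied at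
every radius), `γ₀ ↦ min γ₀ ½` by box monotonicity (`FlowStep.mem_box`), `Mg := 4·Mc`, then №9A :303.

EDGE-TABLE READING (★ P3 `nodeO-cover/P3-EDGE-TABLE-v6.md` §10): this is the one theorem that makes the decision table's second row concrete — IF ⟨27930⟩'s FE half is ever signed on the box
(№11 :129 ⟹ :143 ⟹ `Sig8LR4Box`), K0ᴬ's residue on the box road is {the JOIN's antecedent package (items 27932 ∕ 27929 ∕ 26648's suppliers, as for the run road), the chart rows} — nothing else.

HONEST STATUS.  CONDITIONAL door (kernel-checked implication; every hypothesis OPEN: `Sig8LR4Box` is a CANDIDATE text (Q-25), not a signed item; `JoinAntecedentsCofinal` inhabited nowhere; the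
chart rows OPEN); nothing of Bałaban's renormalization-group analysis is asserted, ported, discharged or refuted; K0ᴬ `Record13SepCoPHInhabitedAx` (stmt-QuantumFields-27238) OPEN — NOTHING of it
is proved here; ⟨27930⟩ ∕ 26648 OPEN; NODE O 0∕1; COUNT 8∕28 · K 1∕4 UNMOVED; finite 𝕋⁴_{L^K} at fixed ε — NOT continuum ∕ OS ∕ Clay; **the Yang–Mills mass gap (Clay) is NOT proved.**

References: T. Bałaban, *Renormalization group approach to lattice gauge field theories. I*, Comm. Math. Phys. 109 (1987) 249–301 [Balaban1987RG1] — Thm 1 p.259, Thm 3 p.264, (1.18)–(1.22)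
pp.263–264, (4.35)–(4.37) pp.290–291, (5.10) p.293; T. Bałaban, *The variational problem and background fields in renormalization group method for lattice gauge theories*, Comm. Math.
Phys. 102 (1985) 277–309 [Balaban1985Variational] — Thm 1 p.279, Prop. 9 p.309; T. Bałaban, *Propagators for lattice gauge theories in a background field*, Comm. Math. Phys. 99 (1985) 389–434 [Balaban1984PropagatorsII] — (2.130) p.246.
-/

noncomputable section

open scoped Topology

namespace Summit.QuantumFields.YangMills.Theorems.K0AxMomentRoad

open Literature.MathematicalPhysics.QuantumFieldTheory.Balaban1983to89.T4Continuum (T4Family)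
open Literature.MathematicalPhysics.QuantumFieldTheory.Balaban1983to89.FlowStep (mem_box)
open Summit.QuantumFields.YangMills.Theorems.K0RecordFormatNames
open Summit.QuantumFields.YangMills.Theorems.PortHRecordJoin (JoinAntecedentsCofinal TokP9L4Old)
open Summit.QuantumFields.YangMills.Theorems.BalabanUVNodesPortS1 (Sig8LR4Box)

/-- ★★★ **K0ᴬ BY NAME FROM ⁸-ON-THE-BOX + THE JOIN's COFINAL ANTECEDENTS + A CHART-ROW SUPPLIER** (the box road's twin of ✓`record13SepCoPHInhabitedAx_of_texts`; binders `h7`, `h121` gone, `h8` on the box):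
`(∀ F, Sig8LR4Box F)` ∧ `(∀ F, JoinAntecedentsCofinal Tok F)` with `Tok ⟹ TokP9L4Old` ∧ [for every admissible `Mc`, `a₀ > 0`, `ε₂₉ > 0`: ONE chart `ιC` with the swap row and the `C²`∕zero∕link rows]
⟹ `Theses.BalabanUVNodes.Record13SepCoPHInhabitedAx`, through ★`record13SepCoPHInhabitedAx_of_chartRowsBox_cofinalRadii` (radius `a₀ := a`, `γ₀ ↦ min γ₀ ½`, `Mg := 4·Mc`).  CONDITIONAL door;
every hypothesis OPEN; K0ᴬ OPEN; the Yang–Mills mass gap is NOT proved.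
[cite: Balaban1987RG1, Thm 1 p.259, Thm 3 p.264, (1.18)–(1.22) pp.263–264, (4.35)–(4.37) pp.290–291, (5.10) p.293; Balaban1985Variational, Thm 1 p.279, Prop. 9 p.309; Balaban1984PropagatorsII, (2.130) p.246] -/
theorem record13SepCoPHInhabitedAx_of_sig8LR4Box_antecedents_chartRows (Tok : T4Family → ℕ → ℝ → Prop)
    (hBr : ∀ (F : T4Family) (Mc : ℕ) (a₀ : ℝ), Tok F Mc a₀ → TokP9L4Old F Mc a₀)
    (h8 : ∀ F, Sig8LR4Box F) (hA : ∀ F, JoinAntecedentsCofinal Tok F)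
    (hRows : ∀ (F : T4Family) (Mc : ℕ) (a₀ ε₂₉ : ℝ), McGuard F Mc → 0 < a₀ → 0 < ε₂₉ →
      letI θ := thetaFill F a₀ ε₂₉; letI := θ.instVβ₁; letI := θ.instVβ₂; letI := θ.instιβ;
      ∃ ιC : (k n : ℕ) → recordW F a₀ ε₂₉ k (recordK₀ F Mc k + n) → (Fin (recordChartDimJ F (recordK₀ F Mc k + n)) → ℂ),
        (∀ (k n : ℕ), ∀ᶠ B in 𝓝 (0 : recordW F a₀ ε₂₉ k (recordK₀ F Mc k + n)), ∀ X : (recordDomSys F Mc k (recordK₀ F Mc k + n)).Dom,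
            ∃ g : recordGaugeGrp F (recordK₀ F Mc k + n), ∀ i ∈ recordCoords F Mc k (recordK₀ F Mc k + n) X,
              recordChartJ F Mc k (recordK₀ F Mc k + n) X (ιC k n B) i =
                recordAct F (recordK₀ F Mc k + n) g (recordChartJ F Mc k (recordK₀ F Mc k + n) X (recordEmbJ F θ k (recordK₀ F Mc k + n) B)) i) ∧
        (∀ k : ℕ, (∀ n : ℕ, ContDiffAt ℝ 2 (ιC k n) 0 ∧ ιC k n 0 = 0) ∧
            ∀ (n : ℕ) (a : θ.ιβ) (l : RespLabel F k (recordK₀ F Mc k + n)),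
              recordGkLocWξ F θ k (recordK₀ F Mc k + n) Finset.univ a l = fun i => fderiv ℝ (ιC k n) 0 (Pi.single l.1 (Pi.single l.2 (θ.bV a))) i)) :
    Summit.QuantumFields.YangMills.Theses.BalabanUVNodes.Record13SepCoPHInhabitedAx := by
  refine record13SepCoPHInhabitedAx_of_chartRowsBox_cofinalRadii fun F a ha => ?_
  obtain ⟨Mth, h8F⟩ := h8 F
  obtain ⟨Mc, hMc, j, c, c₀, c₁, B₃, B₃', a₁, hAnt⟩ := hA F Mth a ha
  obtain ⟨hG0, hc, hc₀, hc₁, hB₃, hB₃', ha₀, ha₁, hThm, hGauge, hUk, hBg, hP9⟩ := hAnt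
  obtain ⟨γ₀, ε₂₉, E₀, κ, α₀, α₁, hγ₀, hε, hE₀, hκ, hα₀, hα₁, hD⟩ :=
    h8F Mc hMc j c c₀ c₁ B₃ B₃' a a₁ hG0 hc hc₀ hc₁ hB₃ hB₃' ha₀ ha₁ hThm hGauge hUk hBg (hBr F Mc a hP9)
  obtain ⟨ιC, hsw, h9⟩ := hRows F Mc a ε₂₉ hG0 ha hε
  refine ⟨a, ha, le_rfl, min γ₀ (1 / 2), ε₂₉, E₀, κ, 4 * (Mc : ℝ), α₀, α₁, Mc, lt_min hγ₀ (by norm_num), min_le_right _ _, hε, hE₀, hκ,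
    hα₀, hα₁, hG0, le_rfl, ιC, fun k v hv => hD k v ?_, hsw, h9⟩
  exact mem_box.mpr fun i => ⟨(mem_box.mp hv i).1, (mem_box.mp hv i).2.trans (min_le_left _ _)⟩

-- standard axioms only
#print axioms record13SepCoPHInhabitedAx_of_sig8LR4Box_antecedents_chartRows

end Summit.QuantumFields.YangMills.Theorems.K0AxMomentRoad

end
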